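import Summits.BirchSwinnertonDyer.BirchSwinnertonDyer.Theorems.PrintCFramBottomClassIndexLawFiveLeLevelDictionaryBetaConsumer
import Summits.BirchSwinnertonDyer.BirchSwinnertonDyer.Theorems.PrintCFramBottomClassIndexLawFiveLeIsogenyLineData
import Summits.BirchSwinnertonDyer.BirchSwinnertonDyer.Theorems.PrintCFramBottomClassIndexLawFiveLeRationalPIsogeny
import Summits.BirchSwinnertonDyer.BirchSwinnertonDyer.Theorems.PrintCFramBottomClassIndexLawFiveLeBorelStableLine
import Mathlib.NumberTheory.NumberField.Cyclotomic.Basic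
import Literature.NumberTheory.EllipticCurves.IsogenyMordellWeilRankProofs
import HarnessLib

/-!
# Route `PrintCFram`, crux C2 `BottomClassIndexLawFiveLe` (stmt-BirchSwinnertonDyer-20372), line
# `eisenstein-resource-bdp-line` (registry v19; LEAD g10 report §2(d)(β), §4 `classFactor_imp_levelPos_or_sha`):
# **THE TRANSVERSE CASE GOES TO THE PARTNER** — for a ψ-TRANSVERSE member `W` the `p`-isogenous partner `W₁`
# (the `−p`-twist, `RationalPIsogeny`) carries `ψ` on its SUB line, so (β) holds for `W₁`: «CLASS FACTOR NON-UNIT ⟹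
# `Ш(W)[p] ≠ 0` ∨ `n_W ≥ 1` ∨ (`Ш(W₁)[p] ≠ 0` ∨ `n_{W₁} ≥ 1`)» on EVERY class member
# (cell `bsd-print-cfram`, width seat `bsd-line-cfram-p1-w5` g3; helper `--supports` 20372; 0 defs, 0 facts, 0 sorry)

HONEST FRAMING. Nothing about BSD is proved here, and nothing of any stub; conditional on Mazur–Wiles Thm. 2 and
`B_{1,ψ̃⁻¹} ≠ 0` as the rest of the (β) lane. w5 g3's `sha_or_levelPos_or_transverse_of_classFactor` (p674651) leaves,
for a ψ-TRANSVERSE member, an everywhere-unramified non-zero class of `H¹(ℚ, W[p]/Φ)`. Here that class is moved to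
the `p`-ISOGENOUS PARTNER: for the rational `p`-isogeny `g : W → W₁` of the class
(`RationalPIsogeny.exists_rational_pIsogeny_noPTorsionPadic_of_cmRamified`: `W₁` globally minimal, CM, CM-ramified),
`ker g|_{W[p]}` is a `Γ_ℚ`-stable line of order `p`, hence EQUAL to `Φ` (uniqueness of the stable line on the class,
w4 g3's `BorelNonScalar.eq_of_stable_of_card_eq_of_cmRamified`, read over `ℚ` through `K = ℚ(ζ₃)`), and `g` induces a
`Γ_ℚ`-equivariant isomorphism `W[p]/Φ ≅ g(W[p]) =: Φ₁ ≤ W₁[p]`, a stable line of `W₁`; cocycles move along it, keeping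
«class `≠ 0`» and «coboundary on every inertia group». Then p673094
(`sha_or_generator_levelPos_of_unramified_sub_class_cmRamified`) applies to `(W₁, Φ₁)`.

* §1 `exists_kerLine_of_isogeny` (the kernel line of a degree-`p` isogeny over `ℚ`, with the injective
  equivariant `W[p]/ker ↪ W₁[p]`); §2 `toAddSubgroup_eq_of_card_eq_of_cmRamified` (uniqueness of the stable line
  over `ℚ`); §3 `exists_imageLine` (the image as a stable line of `W₁` with an equivariant `AddEquiv` from the
  quotient); §4 `exists_unramified_class_map_addEquiv` (transport of an everywhere-unramified non-zero class along
  an equivariant `AddEquiv`); §5 **`sha_or_levelPos_or_partner_of_classFactor`** — THE (β) CONSUMER ON EVERY MEMBER;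
  §6 (appended) **`sha_or_partner_sha_of_classFactor_of_finite`** — the rank-zero form on every member.

THEOREMS ONLY; no definition, no named fact, no `sorry`. BSD is not proved by any of this; no summit statement is
proved by this seat. References: [SilvermanAEC2009] III.4, III.6, X.4; [GreenbergVatsal2000] §2 p. 28;
[GrossLMS1991] §9; [MazurWiles1984] Thm. 2; the LEAD g10 report §2(d), §4.
-/

set_option autoImplicit false
-- `…BirchSwinnertonDyer.BirchSwinnertonDyer.Theorems…` is the problem's mandated namespace (D-0017).
set_option linter.dupNamespace false

noncomputable section

open scoped Classical Pointwise

namespace Summit.BirchSwinnertonDyer.BirchSwinnertonDyer.Theorems.PrintCFram.LevelDictionaryBeta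

open NumberField IsDedekindDomain Field WeierstrassCurve DirichletCharacter
open Literature.NumberTheory.EllipticCurves Literature.NumberTheory.GaloisRepresentations
  Literature.NumberTheory.EllipticCurves.KrizLi2019 Literature.NumberTheory.NumberFields
  Literature.NumberTheory.EllipticCurves.GreenbergSelmer
open Literature.NumberTheory.EllipticCurves.Rank1Residual (CMRamified)
open Summit.BirchSwinnertonDyer.Rank1Residual
open Summit.BirchSwinnertonDyer.BirchSwinnertonDyer.Theorems.PrintCFram.LevelDictionaryAlpha
open Summit.BirchSwinnertonDyer.BirchSwinnertonDyer.Theorems.PrintCFram.LevelDictionary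

variable {p : ℕ} [hp : Fact p.Prime]

/-! ## §1 The kernel line of a rational `p`-isogeny, over `ℚ` -/

section KerLine

variable (W W₁ : WeierstrassCurve ℚ) [W.IsElliptic] [W₁.IsElliptic] (g : Isogeny W W₁)

omit [W.IsElliptic] [W₁.IsElliptic] hp in
/-- **The kernel line of a degree-`p` isogeny `g : W → W₁` over `ℚ`** — a `Γ_ℚ`-stable subgroup `S ≤ W[p]` of order `p`
(`ker g ≤ W[p]`, `IsogenyLineData.ker_le_geomTorsion`) together with the INJECTIVE `Γ_ℚ`-equivariant map
`W[p]/S → W₁[p]` induced by `g` (over `ℚ` itself; `IsogenyLineData.exists_stableSubgroup_of_isogeny` is the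
base-changed version). [cite: SilvermanAEC2009, III.4 (isogenies) and VIII.§1] [cite: GreenbergVatsal2000, §2 p. 28] -/
theorem exists_kerLine_of_isogeny (hg : g.degree = p) :
    ∃ (S : X2.ResidualDevissageModules.StableSubgroup (absoluteGaloisGroup ℚ) (W.geomTorsion (p : ℤ)))
      (gbar : S.Quot →+ W₁.geomTorsion (p : ℤ)),
      Nat.card S.Sub = p ∧ Function.Injective gbar ∧
      (∀ (σ : absoluteGaloisGroup ℚ) (y : S.Quot), gbar (σ • y) = σ • gbar y) ∧
      (∀ P : W.geomTorsion (p : ℤ), P ∈ S.toAddSubgroup ↔ g (P : W.geomPoints) = 0) := by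
  -- the restriction `g_p : W[p] → W₁[p]` of `g`, `Γ_ℚ`-equivariant
  let gp : W.geomTorsion (p : ℤ) →+ W₁.geomTorsion (p : ℤ) :=
    (g.toAddMonoidHom.restrict (W.geomTorsion (p : ℤ))).codRestrict (W₁.geomTorsion (p : ℤ)) fun P ↦ by
      have hP : (p : ℤ) • (P : W.geomPoints) = 0 :=
        (Submodule.mem_torsionBy_iff (p : ℤ) (P : W.geomPoints)).mp P.2
      change g.toAddMonoidHom (P : W.geomPoints) ∈ W₁.geomTorsion (p : ℤ)
      refine (Submodule.mem_torsionBy_iff (p : ℤ) _).mpr ?_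
      rw [← map_zsmul, hP, map_zero]
  have hgp : ∀ P : W.geomTorsion (p : ℤ), ((gp P : W₁.geomTorsion (p : ℤ)) : W₁.geomPoints) =
      g (P : W.geomPoints) := fun _ ↦ rfl
  have hgp_smul : ∀ (σ : absoluteGaloisGroup ℚ) (P : W.geomTorsion (p : ℤ)), gp (σ • P) = σ • gp P := fun σ P ↦ by
    apply Subtype.ext
    rw [hgp, AddSubgroup.torsionBy.coe_smul, AddSubgroup.torsionBy.coe_smul, hgp, g.map_smul]
  -- `#ker g_p = p`
  have hgp_ker : Nat.card gp.ker = p := by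
    have hle := IsogenyLineData.ker_le_geomTorsion g hg
    have key : Nat.card gp.ker = Nat.card g.toAddMonoidHom.ker := Nat.card_congr
      { toFun := fun x ↦ ⟨(x.1 : W.geomPoints), by
          have hx := x.2
          rw [AddMonoidHom.mem_ker] at hx ⊢
          have := congrArg (Subtype.val : W₁.geomTorsion (p : ℤ) → W₁.geomPoints) hx
          rw [hgp] at this
          exact this⟩
        invFun := fun P ↦ ⟨⟨P.1, hle P.2⟩, by
          rw [AddMonoidHom.mem_ker]
          apply Subtype.ext
          rw [hgp]
          exact P.2⟩
        left_inv := fun x ↦ rfl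
        right_inv := fun P ↦ rfl }
    rw [key]
    exact hg
  let S : X2.ResidualDevissageModules.StableSubgroup (absoluteGaloisGroup ℚ) (W.geomTorsion (p : ℤ)) :=
    ⟨gp.ker, fun σ {Q} hQ ↦ by
      rw [AddMonoidHom.mem_ker] at hQ ⊢
      rw [hgp_smul, hQ, smul_zero]⟩
  let gbar : S.Quot →+ W₁.geomTorsion (p : ℤ) := QuotientAddGroup.kerLift gp
  have hgbar : ∀ m, gbar (S.proj m) = gp m := fun m ↦ QuotientAddGroup.kerLift_mk gp m
  refine ⟨S, gbar, hgp_ker, QuotientAddGroup.kerLift_injective gp, fun σ y ↦ ?_, fun P ↦ ?_⟩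
  · obtain ⟨m, rfl⟩ := S.proj_surjective y
    rw [S.smul_proj, hgbar, hgbar, hgp_smul]
  · change P ∈ gp.ker ↔ _
    rw [AddMonoidHom.mem_ker]
    constructor
    · intro h
      have := congrArg (Subtype.val : W₁.geomTorsion (p : ℤ) → W₁.geomPoints) h
      rwa [hgp] at this
    · intro h
      exact Subtype.ext (by rw [hgp]; exact h)

end KerLine

/-! ## §2 Uniqueness of the stable line over `ℚ`, on the class -/

section Unique

variable (W : WeierstrassCurve ℚ) [W.IsElliptic]

/-- **Uniqueness of the `Γ_ℚ`-stable line of order `p` on the CM-ramified class** (`W/ℚ` CM, `p ≥ 5` CM-ramified): two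
`Γ_ℚ`-stable subgroups of `W[p]` of order `p` are EQUAL — w4 g3's uniqueness over a quadratic field
(`BorelNonScalar.eq_of_stable_of_card_eq_of_cmRamified`, both are `ker √−p`), read through `K = ℚ(ζ₃)`.
[cite: GrossLMS1991, §9 proof of Prop. 9.3] [cite: GreenbergVatsal2000, §2 (p. 28)] -/
theorem toAddSubgroup_eq_of_card_eq_of_cmRamified (hCM : W.HasCM) (h5 : 5 ≤ p) (hram : CMRamified W p)
    (Φ₁ Φ₂ : X2.ResidualDevissageModules.StableSubgroup (absoluteGaloisGroup ℚ) (W.geomTorsion (p : ℤ)))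
    (hc₁ : Nat.card Φ₁.Sub = p) (hc₂ : Nat.card Φ₂.Sub = p) : Φ₁.toAddSubgroup = Φ₂.toAddSubgroup := by
  -- a quadratic field: `K = ℚ(ζ₃)`
  haveI : IsCyclotomicExtension {3} ℚ (CyclotomicField 3 ℚ) := CyclotomicField.isCyclotomicExtension 3 ℚ
  have hK2 : Module.finrank ℚ (CyclotomicField 3 ℚ) = 2 := by
    rw [IsCyclotomicExtension.Rat.finrank 3 (CyclotomicField 3 ℚ)]
    decide
  exact BorelNonScalar.eq_of_stable_of_card_eq_of_cmRamified W p (CyclotomicField 3 ℚ) hCM h5 hram hK2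
    (fun σ P hP ↦ Φ₁.smul_mem' _ hP) hc₁ (fun σ P hP ↦ Φ₂.smul_mem' _ hP) hc₂

end Unique

/-! ## §3 The image line in the partner and the equivariant isomorphism from the quotient -/

section ImageLine

variable {G : Type} [Group G] {N : Type} [AddCommGroup N] [DistribMulAction G N]

/-- **An injective equivariant additive map onto a stable subgroup.** For `Γ`-modules `Q`, `N` and an injective
equivariant `j : Q →+ N`, the range of `j` is a `Γ`-stable subgroup `Φ₁ ≤ N` and `j` is an equivariant additive
isomorphism `Q ≃+ Φ₁.Sub`. [folklore] -/
theorem exists_imageLine {Q : Type} [AddCommGroup Q] [DistribMulAction G Q] (j : Q →+ N)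
    (hj : Function.Injective j) (hjs : ∀ (σ : G) (y : Q), j (σ • y) = σ • j y) :
    ∃ (Φ₁ : X2.ResidualDevissageModules.StableSubgroup G N) (e : Q ≃+ Φ₁.Sub),
      (∀ (σ : G) (y : Q), e (σ • y) = σ • e y) ∧ (∀ y : Q, Φ₁.incl (e y) = j y) ∧
      Nat.card Φ₁.Sub = Nat.card Q := by
  let Φ₁ : X2.ResidualDevissageModules.StableSubgroup G N :=
    ⟨j.range, fun σ {n} hn ↦ by
      obtain ⟨y, rfl⟩ := hn
      exact ⟨σ • y, hjs σ y⟩⟩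
  let e₀ : Q ≃+ j.range := AddMonoidHom.ofInjective hj
  let e : Q ≃+ Φ₁.Sub := e₀
  have he : ∀ y : Q, Φ₁.incl (e y) = j y := fun _ ↦ rfl
  refine ⟨Φ₁, e, fun σ y ↦ ?_, he, ?_⟩
  · apply Φ₁.incl_injective
    rw [Φ₁.incl_smul, he, he, hjs]
  · exact (Nat.card_congr e.toEquiv).symm

end ImageLine

/-! ## §4 Transport of an everywhere-unramified non-zero class along an equivariant isomorphism -/

section Transport

variable {K : Type} [Field K] [NumberField K]
variable {A B : Type} [AddCommGroup A] [AddCommGroup B]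
  [DistribMulAction (absoluteGaloisGroup K) A] [DistribMulAction (absoluteGaloisGroup K) B]
  [TopologicalSpace A] [DiscreteTopology A] [TopologicalSpace B] [DiscreteTopology B]

omit [NumberField K] in
/-- **Transport of an everywhere-unramified NON-ZERO class along an equivariant additive isomorphism** `e : A ≃+ B`
of discrete `Γ_K`-modules: `e ∘ w` is a continuous crossed homomorphism with non-zero class (a principal `e ∘ w`
pulls back to a principal `w` along `e⁻¹`), a coboundary on every inertia group if `w` is.
[cite: SerreGaloisCohomology1997, I.§5.1 (functoriality of H¹)] -/
theorem exists_unramified_class_map_addEquiv (e : A ≃+ B)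
    (he : ∀ (σ : absoluteGaloisGroup K) (a : A), e (σ • a) = σ • e a)
    (w : contOneCocycles (discreteTopRep (absoluteGaloisGroup K) A)) (hw : oneCocycleClass _ w ≠ 0)
    (hwI : ∀ (v : HeightOneSpectrum (𝓞 K)) (𝔓 : Ideal (absIntegers (𝓞 K) K)), 𝔓 ∈ v.primesAbove →
      ∃ a : A, ∀ γ ∈ 𝔓.inertia (absoluteGaloisGroup K), w.1 γ = γ • a - a) :
    ∃ z : contOneCocycles (discreteTopRep (absoluteGaloisGroup K) B),
      oneCocycleClass _ z ≠ 0 ∧ (∀ γ, z.1 γ = e (w.1 γ)) ∧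
      ∀ (v : HeightOneSpectrum (𝓞 K)) (𝔓 : Ideal (absIntegers (𝓞 K) K)), 𝔓 ∈ v.primesAbove →
        ∃ b : B, ∀ γ ∈ 𝔓.inertia (absoluteGaloisGroup K), z.1 γ = γ • b - b := by
  let z : contOneCocycles (discreteTopRep (absoluteGaloisGroup K) B) :=
    contOneCocycles.pullback (ContinuousMonoidHom.id _)
      (resHomOfEquivariant (ContinuousMonoidHom.id _) e.toAddMonoidHom (fun σ a ↦ he σ a)) w
  have hz : ∀ γ, z.1 γ = e (w.1 γ) := fun γ ↦ rfl
  refine ⟨z, fun h0 ↦ hw ?_, hz, fun v 𝔓 h𝔓 ↦ ?_⟩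
  · obtain ⟨b₀, hb₀⟩ := (oneCocycleClass_eq_zero_iff _ z).1 h0
    refine (oneCocycleClass_eq_zero_iff _ w).2 ⟨e.symm b₀, fun γ ↦ ?_⟩
    have hb : z.1 γ = γ • b₀ - b₀ := hb₀ γ
    change w.1 γ = γ • e.symm b₀ - e.symm b₀
    apply e.injective
    rw [← hz, hb, map_sub, he, e.apply_symm_apply]
  · obtain ⟨a, ha⟩ := hwI v 𝔓 h𝔓
    exact ⟨e a, fun γ hγ ↦ by rw [hz, ha γ hγ, map_sub, he]⟩

end Transport

/-! ## §5 The (β) consumer on EVERY member: the transverse case goes to the partner -/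

section Partner

variable (W : WeierstrassCurve ℚ) [W.IsElliptic] [W.IsGloballyMinimal]

omit [W.IsGloballyMinimal] in
/-- **The quotient of the unique stable line embeds into the partner's `p`-torsion.** On the class (`W` CM, `p ≥ 5`
CM-ramified), for ANY `Γ_ℚ`-stable line `Φ ≤ W[p]` of order `p` and any isogeny `g : W → W₁` over `ℚ` of degree `p`:
`Φ = ker g|_{W[p]}` (uniqueness), so `g` induces an INJECTIVE `Γ_ℚ`-equivariant `W[p]/Φ → W₁[p]`.
[cite: GrossLMS1991, §9] [cite: SilvermanAEC2009, III.4] -/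
theorem exists_quot_embedding_of_isogeny (hCM : W.HasCM) (h5 : 5 ≤ p) (hram : CMRamified W p)
    (Φ : X2.ResidualDevissageModules.StableSubgroup (absoluteGaloisGroup ℚ) (W.geomTorsion (p : ℤ)))
    (hcard : Nat.card Φ.Sub = p) (W₁ : WeierstrassCurve ℚ) [W₁.IsElliptic] (g : Isogeny W W₁) (hg : g.degree = p) :
    ∃ j : Φ.Quot →+ W₁.geomTorsion (p : ℤ), Function.Injective j ∧
      ∀ (σ : absoluteGaloisGroup ℚ) (y : Φ.Quot), j (σ • y) = σ • j y := by
  obtain ⟨S, gbar, hS, hinj, hequiv, -⟩ := exists_kerLine_of_isogeny W W₁ g hg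
  have heq : Φ.toAddSubgroup = S.toAddSubgroup := toAddSubgroup_eq_of_card_eq_of_cmRamified W hCM h5 hram Φ S hcard hS
  let ι : Φ.Quot ≃+ S.Quot := QuotientAddGroup.quotientAddEquivOfEq heq
  have hι : ∀ m : W.geomTorsion (p : ℤ), ι (Φ.proj m) = S.proj m := fun m ↦
    QuotientAddGroup.quotientAddEquivOfEq_mk heq m
  have hιs : ∀ (σ : absoluteGaloisGroup ℚ) (y : Φ.Quot), ι (σ • y) = σ • ι y := fun σ y ↦ by
    obtain ⟨m, rfl⟩ := Φ.proj_surjective y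
    rw [Φ.smul_proj, hι, hι, S.smul_proj]
  refine ⟨gbar.comp ι.toAddMonoidHom, hinj.comp ι.injective, fun σ y ↦ ?_⟩
  change gbar (ι (σ • y)) = σ • gbar (ι y)
  rw [hιs, hequiv]

/-- **(β) ON EVERY CLASS MEMBER: CLASS FACTOR NON-UNIT ⟹ (`Ш(W)[p] ≠ 0` ∨ `n_W ≥ 1`) OR THE SAME FOR THE `p`-ISOGENOUS
PARTNER (CONDITIONAL on Mazur–Wiles Thm. 2).** `W/ℚ` globally minimal with CM, `p ≥ 5` CM-RAMIFIED; `(f, ψ, ω)` with `ψ` odd,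
`ω` Teichmüller and the trace form; `B_{1,ψ̃⁻¹} ≠ 0` and the CLASS FACTOR NON-UNIT `‖B_{1,ψ̃⁻¹}‖_p ≤ p⁻¹` (B1's premise); `g`
a generator of `W(ℚ)` modulo torsion. THEN EITHER `Ш(W/ℚ) ∋ c ≠ 0` with `p • c = 0` or `∃ Q : W(ℚ_[p]), p • Q = toPadicPoint p g`
(ψ-ALIGNED), OR (ψ-TRANSVERSE) there is a globally minimal CM curve `W₁`, CM-ramified at `p`, with an isogeny `W → W₁`
over `ℚ` of degree `p` (the `−p`-twist of the class), such that for EVERY generator `g₁` of `W₁(ℚ)` modulo torsion: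
`Ш(W₁/ℚ) ∋ c ≠ 0` with `p • c = 0` or `∃ Q : W₁(ℚ_[p]), p • Q = toPadicPoint p g₁`. So on every Eisenstein-IRREGULAR member
the isogeny class `{W, W₁}` carries non-trivial `Ш[p]` or a `p`-divisible generator — LEAD g10's (β) for B1
`stub_bsdp_of_classFactor`, closed over the choice of model. [cite: MazurWiles1984, Thm. 2 (p. 216)]
[cite: SilvermanAEC2009, Thm. X.4.2(a), III.4 and VIII.§2] [cite: GreenbergLNM1716, §3 Thm. 1.2 and §4 Lemma 4.2]
[cite: GrossLMS1991, §9] -/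
theorem sha_or_levelPos_or_partner_of_classFactor
    (hMW : MazurWiles1984.thm2_card_oddChiClassGroup_eq_bernoulli)
    (hCM : W.HasCM) (hram : CMRamified W p) (h5 : 5 ≤ p)
    {f : ℕ} [NeZero f] (ψ : DirichletCharacter ℚ_[p] f) (ω : DirichletCharacter ℚ_[p] p)
    (hψ : ψ.Odd) (hω : IsTeichmullerCharacter ω)
    (hss : ∀ ℓ : ℕ, ℓ.Prime → ¬ (ℓ ∣ p * W.conductorNorm ℤ) →
      ‖((W.LFunction ℓ : ℤ) : ℚ_[p]) - (ψ (ℓ : ZMod f) + ψ⁻¹ (ℓ : ZMod f) * ω (ℓ : ZMod p))‖ < 1)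
    (hB0 : bernoulliOnePrim ψ⁻¹ ≠ 0) (hB : ‖bernoulliOnePrim ψ⁻¹‖ ≤ (p : ℝ)⁻¹)
    {g : W.toAffine.Point}
    (hgen : ∀ R : W.toAffine.Point, ∃ (k : ℤ) (T : W.toAffine.Point), IsOfFinAddOrder T ∧ R = k • g + T) :
    ((∃ c ∈ W.sha, c ≠ 0 ∧ p • c = 0) ∨
      ∃ Q : (W.baseChange ℚ_[p]).toAffine.Point, p • Q = W.toPadicPoint p g) ∨
    ∃ (W₁ : WeierstrassCurve ℚ) (_ : W₁.IsElliptic) (_ : W₁.IsGloballyMinimal),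
      W₁.HasCM ∧ CMRamified W₁ p ∧ (∃ φ : Isogeny W W₁, φ.degree = p) ∧
      ∀ g₁ : W₁.toAffine.Point,
        (∀ R : W₁.toAffine.Point, ∃ (k : ℤ) (T : W₁.toAffine.Point), IsOfFinAddOrder T ∧ R = k • g₁ + T) →
        (∃ c ∈ W₁.sha, c ≠ 0 ∧ p • c = 0) ∨
          ∃ Q : (W₁.baseChange ℚ_[p]).toAffine.Point, p • Q = W₁.toPadicPoint p g₁ := by
  rcases sha_or_levelPos_or_transverse_of_classFactor W hMW hCM hram h5 ψ ω hψ hω hss hB0 hB hgen with h | h | h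
  · exact Or.inl (Or.inl h)
  · exact Or.inl (Or.inr h)
  · right
    obtain ⟨Φ, w, hcard, hw, hwI⟩ := h
    -- the partner and the rational `p`-isogeny
    obtain ⟨W₁, _, _, hCM₁, hram₁, -, φ, hφ⟩ :=
      RationalPIsogeny.exists_rational_pIsogeny_noPTorsionPadic_of_cmRamified W p hCM h5 hram
    refine ⟨W₁, ‹_›, ‹_›, hCM₁, hram₁, ⟨φ, hφ⟩, fun g₁ hgen₁ ↦ ?_⟩
    -- `W[p]/Φ ↪ W₁[p]`, its image line `Φ₁` and the transported class
    obtain ⟨j, hj, hjs⟩ := exists_quot_embedding_of_isogeny W hCM h5 hram Φ hcard W₁ φ hφ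
    obtain ⟨Φ₁, e, hes, -, hcard₁⟩ := exists_imageLine (G := absoluteGaloisGroup ℚ) j hj hjs
    have hcardQ : Nat.card Φ.Quot = p := HerbrandLineRestriction.natCard_quot_eq_of_card_sub W Φ hcard
    rw [hcardQ] at hcard₁
    obtain ⟨z, hz, -, hzI⟩ := exists_unramified_class_map_addEquiv (K := ℚ) e hes w hw hwI
    -- the class-side local inputs for `(W₁, Φ₁)` (w6 g3)
    have hQΓ : ∀ q : Φ₁.Quot, (∀ γ : absoluteGaloisGroup ℚ, γ • q = q) → q = 0 := by
      intro q hq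
      obtain ⟨v, hv⟩ := exists_heightOneSpectrum_rat_natCast_mem hp.out
      exact quot_eq_zero_of_forall_inertia_smul_eq_at_p W₁ Φ₁ hCM₁ h5 hram₁ hcard₁ hv
        (adicCompletionPrime_mem_primesAbove ℚ v) q fun γ _ ↦ hq γ
    have hSp : ∀ v : HeightOneSpectrum (𝓞 ℚ), ((p : ℕ) : 𝓞 ℚ) ∈ v.asIdeal →
        ∀ s : Φ₁.Sub, (∀ γ ∈ (adicCompletionPrime ℚ v).inertia (absoluteGaloisGroup ℚ), γ • s = s) → s = 0 :=
      fun v hv s hs ↦ sub_eq_zero_of_forall_inertia_smul_eq_at_p W₁ Φ₁ hCM₁ h5 hram₁ hcard₁ hv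
        (adicCompletionPrime_mem_primesAbove ℚ v) s hs
    have hbad : ∀ v : HeightOneSpectrum (𝓞 ℚ), ¬ W₁.HasGoodReductionAt v → ((p : ℕ) : 𝓞 ℚ) ∉ v.asIdeal →
        ∀ P : (W₁.baseChange (v.adicCompletion ℚ)).toAffine.Point, p • P = 0 → P = 0 :=
      fun v hbadv hpv ↦ forall_prime_nsmul_eq_zero_adicCompletion_of_bad (K := ℚ) W₁ hCM₁ hram₁ h5 hpv hbadv
    exact sha_or_generator_levelPos_of_unramified_sub_class_cmRamified W₁ p hCM₁ h5 hram₁ hgen₁ Φ₁ hQΓ hSp hbad z hz hzI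

end Partner

/-! ## §6 (appended) The rank-zero form on every member -/

section PartnerFinite

variable (W : WeierstrassCurve ℚ) [W.IsElliptic] [W.IsGloballyMinimal]

/-- **(β) RANK-ZERO FORM ON EVERY CLASS MEMBER: CLASS FACTOR NON-UNIT ⟹ `Ш(W)[p] ≠ 0` OR `Ш(W₁)[p] ≠ 0` FOR THE
`p`-ISOGENOUS PARTNER (CONDITIONAL on Mazur–Wiles Thm. 2).** `W/ℚ` globally minimal with CM, `p ≥ 5` CM-RAMIFIED, `W(ℚ)`
FINITE; `(f, ψ, ω)` odd datum with the trace form; `B_{1,ψ̃⁻¹} ≠ 0` and `‖B_{1,ψ̃⁻¹}‖_p ≤ p⁻¹`. THEN `Ш(W/ℚ)` has a non-zero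
element killed by `p`, OR there is a globally minimal CM curve `W₁`, CM-ramified at `p`, `p`-isogenous to `W` over `ℚ` (so
`W₁(ℚ)` is finite too, `IsIsogenous.mordellWeilRank_eq`), with `Ш(W₁/ℚ) ∋ c ≠ 0`, `p • c = 0`. (The transverse class moves to
the partner's sub line as in `sha_or_levelPos_or_partner_of_classFactor`; then `sha_of_unramified_sub_class_of_finite_cmRamified`.)
This is the descent half of the `L`-value reading of stub C / B2′: an Eisenstein-IRREGULAR RANK-ZERO member's isogeny class
carries non-trivial `Ш[p]`. [cite: MazurWiles1984, Thm. 2 (p. 216)] [cite: SilvermanAEC2009, Thm. X.4.2(a) and III.6.2]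
[cite: GrossLMS1991, §9] [cite: MilneADT2006, proof of Thm. I.7.3] -/
theorem sha_or_partner_sha_of_classFactor_of_finite
    (hMW : MazurWiles1984.thm2_card_oddChiClassGroup_eq_bernoulli)
    (hCM : W.HasCM) (hram : CMRamified W p) (h5 : 5 ≤ p) (hfin : Finite W.toAffine.Point)
    {f : ℕ} [NeZero f] (ψ : DirichletCharacter ℚ_[p] f) (ω : DirichletCharacter ℚ_[p] p)
    (hψ : ψ.Odd) (hω : IsTeichmullerCharacter ω)
    (hss : ∀ ℓ : ℕ, ℓ.Prime → ¬ (ℓ ∣ p * W.conductorNorm ℤ) →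
      ‖((W.LFunction ℓ : ℤ) : ℚ_[p]) - (ψ (ℓ : ZMod f) + ψ⁻¹ (ℓ : ZMod f) * ω (ℓ : ZMod p))‖ < 1)
    (hB0 : bernoulliOnePrim ψ⁻¹ ≠ 0) (hB : ‖bernoulliOnePrim ψ⁻¹‖ ≤ (p : ℝ)⁻¹) :
    (∃ c ∈ W.sha, c ≠ 0 ∧ p • c = 0) ∨
    ∃ (W₁ : WeierstrassCurve ℚ) (_ : W₁.IsElliptic) (_ : W₁.IsGloballyMinimal),
      W₁.HasCM ∧ CMRamified W₁ p ∧ (∃ φ : Isogeny W W₁, φ.degree = p) ∧ Finite W₁.toAffine.Point ∧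
      ∃ c ∈ W₁.sha, c ≠ 0 ∧ p • c = 0 := by
  rcases sha_or_transverse_of_classFactor_of_finite W hMW hCM hram h5 hfin ψ ω hψ hω hss hB0 hB with h | h
  · exact Or.inl h
  · right
    obtain ⟨Φ, w, hcard, hw, hwI⟩ := h
    obtain ⟨W₁, _, _, hCM₁, hram₁, -, φ, hφ⟩ :=
      RationalPIsogeny.exists_rational_pIsogeny_noPTorsionPadic_of_cmRamified W p hCM h5 hram
    have hiso : IsIsogenous W W₁ := ⟨φ⟩
    -- `W₁(ℚ)` is finite: rank is an isogeny invariant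
    have hr0 : W.mordellWeilRank = 0 := W.mordellWeilRank_eq_zero_iff_holds.mpr hfin
    have hfin₁ : Finite W₁.toAffine.Point :=
      W₁.mordellWeilRank_eq_zero_iff_holds.mp (hiso.mordellWeilRank_eq.symm.trans hr0)
    refine ⟨W₁, ‹_›, ‹_›, hCM₁, hram₁, ⟨φ, hφ⟩, hfin₁, ?_⟩
    obtain ⟨j, hj, hjs⟩ := exists_quot_embedding_of_isogeny W hCM h5 hram Φ hcard W₁ φ hφ
    obtain ⟨Φ₁, e, hes, -, hcard₁⟩ := exists_imageLine (G := absoluteGaloisGroup ℚ) j hj hjs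
    have hcardQ : Nat.card Φ.Quot = p := HerbrandLineRestriction.natCard_quot_eq_of_card_sub W Φ hcard
    rw [hcardQ] at hcard₁
    obtain ⟨z, hz, -, hzI⟩ := exists_unramified_class_map_addEquiv (K := ℚ) e hes w hw hwI
    have hQΓ : ∀ q : Φ₁.Quot, (∀ γ : absoluteGaloisGroup ℚ, γ • q = q) → q = 0 := by
      intro q hq
      obtain ⟨v, hv⟩ := exists_heightOneSpectrum_rat_natCast_mem hp.out
      exact quot_eq_zero_of_forall_inertia_smul_eq_at_p W₁ Φ₁ hCM₁ h5 hram₁ hcard₁ hv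
        (adicCompletionPrime_mem_primesAbove ℚ v) q fun γ _ ↦ hq γ
    have hSp : ∀ v : HeightOneSpectrum (𝓞 ℚ), ((p : ℕ) : 𝓞 ℚ) ∈ v.asIdeal →
        ∀ s : Φ₁.Sub, (∀ γ ∈ (adicCompletionPrime ℚ v).inertia (absoluteGaloisGroup ℚ), γ • s = s) → s = 0 :=
      fun v hv s hs ↦ sub_eq_zero_of_forall_inertia_smul_eq_at_p W₁ Φ₁ hCM₁ h5 hram₁ hcard₁ hv
        (adicCompletionPrime_mem_primesAbove ℚ v) s hs
    have hbad : ∀ v : HeightOneSpectrum (𝓞 ℚ), ¬ W₁.HasGoodReductionAt v → ((p : ℕ) : 𝓞 ℚ) ∉ v.asIdeal →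
        ∀ P : (W₁.baseChange (v.adicCompletion ℚ)).toAffine.Point, p • P = 0 → P = 0 :=
      fun v hbadv hpv ↦ forall_prime_nsmul_eq_zero_adicCompletion_of_bad (K := ℚ) W₁ hCM₁ hram₁ h5 hpv hbadv
    exact sha_of_unramified_sub_class_of_finite_cmRamified W₁ p hCM₁ h5 hram₁ hfin₁ Φ₁ hQΓ hSp hbad z hz hzI

end PartnerFinite

end Summit.BirchSwinnertonDyer.BirchSwinnertonDyer.Theorems.PrintCFram.LevelDictionaryBeta

end
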